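import Mathlib
import HarnessLib
import Literature.Computability.AlgebraicComplexity.PatternExpressions
import Literature.Combinatorics.SimpleGraph.TreeDecomposition
import Summits.ValiantsHypothesis.ValiantsHypothesis.Theorems.MonotoneRestorationMonotoneRestorationQPLinearWidthDefs

/-!
# Route MonotoneRestoration, crux `MonotoneRestorationQP` (stmt-15886), line `linear-width` —
# (Q1) "DETERMINED ⇒ NARROW" IS TRIVIALLY TRUE ON EVERY FINITE POINT SET

Helper file (`--supports stmt-ValiantsHypothesis-15886`), def-free.  Companion of
`…LinearWidthCuspTest.lean` (the cusp / seminormality reading of (Q1)).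

(Q1) asks whether a polynomial whose values on ALL of `ℂ^{n×n}` are determined by `HomIndist n k` lies in
the span of the bounded-treewidth homomorphism polynomials.  This file records, kernel-checked, that the
difficulty is ENTIRELY in the passage from finite point sets to the continuum: on any FINITE family of
points — in particular on the `2^{n²}` zero-one matrices of Dwivedi–Pago–Seppelt's `tw`-counting width
(their Def. 7.1 is stated on `{0,1}^{n×m}` only) — a determined function IS the restriction of an element of
the algebra generated by the separating polynomials, by Lagrange-type interpolation inside that algebra:

* `exists_mem_adjoin_eval_eq` — ABSTRACT FORM: `ι` finite, points `A : ι → (σ → ℂ)`, generators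
  `S ⊆ ℂ[σ]`; if `p` takes equal values at any two points at which all `q ∈ S` agree, then some
  `r ∈ Algebra.adjoin ℂ S` agrees with `p` at every `A i`.  Proof: for each non-agreeing ordered pair pick a
  separating generator; the product `e_i = Π_j (q_ij − q_ij(A_j))/(q_ij(A_i) − q_ij(A_j))` over the `j` not
  agreeing with `i` lies in the algebra and is the indicator of the agreement class of `i`; average.
* `exists_mem_adjoin_homPoly_eval_eq` — THE HOM-POLYNOMIAL FORM: for every finite family of points of
  `ℂ^{n×n}` and every `p` determined by `HomIndist n k` (vocabulary of `…LinearWidthDefs.lean`), some element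
  of `Algebra.adjoin ℂ {hom_{F,n} : tw F < k}` agrees with `p` on the family.  (The adjoin is the SPAN of the
  `hom_{F,n}`, `tw F < k`, since disjoint unions of patterns multiply — `HomPolyBasics.homPoly_disjointUnion`
  — and do not raise treewidth; that identification is not needed here and not claimed in the kernel.)

So the `{0,1}`-version of (Q1) holds at every `(n, k)` with NO loss of width, while the `ℂ^{n×n}`-version is
the seminormality question of `…CuspTest.lean`.  Honest label: elementary linear algebra; no stub closed;
VP ≠ VNP not moved. [cite: DwivediPagoSeppelt2026, Def. 7.1 and Remark 7.2]
-/

-- `Summit.ValiantsHypothesis.ValiantsHypothesis.…` is the tree's mandated namespace (Sub = Summit).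
set_option linter.dupNamespace false

noncomputable section

namespace Summit.ValiantsHypothesis.ValiantsHypothesis.Theorems.MonotoneRestorationQPLinearWidth

namespace FiniteDetermined

open Literature.Computability.AlgebraicComplexity MvPolynomial

/-! ### Elements of the generated algebra respect agreement of the generators -/

/-- If all generators `q ∈ S` agree at two points, so does every element of `Algebra.adjoin ℂ S`.
[folklore] -/
theorem eval_eq_of_mem_adjoin {σ : Type*} {S : Set (MvPolynomial σ ℂ)} {x y : σ → ℂ}
    (hxy : ∀ q ∈ S, eval x q = eval y q) {r : MvPolynomial σ ℂ} (hr : r ∈ Algebra.adjoin ℂ S) :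
    eval x r = eval y r := by
  refine Algebra.adjoin_induction (hx := hr) (fun q hq => hxy q hq) (fun c => by simp)
    (fun a b _ _ ha hb => by simp [ha, hb]) (fun a b _ _ ha hb => by simp [ha, hb])

/-! ### Interpolation inside the generated algebra on a finite point set -/

/-- **Determined on a finite point set ⇒ restriction of an element of the generated algebra.**
Let `ι` be finite, `A : ι → (σ → ℂ)` points and `S` a set of polynomials.  If `p` takes equal values at any
two of the points at which all members of `S` agree, then some `r ∈ Algebra.adjoin ℂ S` agrees with `p` at
every point `A i`. [folklore] -/
theorem exists_mem_adjoin_eval_eq {σ ι : Type*} [Fintype ι] (S : Set (MvPolynomial σ ℂ))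
    (A : ι → σ → ℂ) (p : MvPolynomial σ ℂ)
    (hp : ∀ i j, (∀ q ∈ S, eval (A i) q = eval (A j) q) → eval (A i) p = eval (A j) p) :
    ∃ r ∈ Algebra.adjoin ℂ S, ∀ i, eval (A i) r = eval (A i) p := by
  classical
  -- separating generators for non-agreeing ordered pairs
  have hsep : ∀ i j : ι, ¬ (∀ q ∈ S, eval (A i) q = eval (A j) q) →
      ∃ q ∈ S, eval (A i) q ≠ eval (A j) q := by
    intro i j h
    push Not at h
    exact h
  choose! qs hqS hqne using hsep
  -- the indicator of the agreement class of `i`, inside the algebra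
  set e : ι → MvPolynomial σ ℂ := fun i =>
    ∏ j ∈ Finset.univ.filter (fun j => ¬ ∀ q ∈ S, eval (A i) q = eval (A j) q),
      C ((eval (A i) (qs i j) - eval (A j) (qs i j))⁻¹) * (qs i j - C (eval (A j) (qs i j))) with he_def
  have he_mem : ∀ i, e i ∈ Algebra.adjoin ℂ S := by
    intro i
    refine Subalgebra.prod_mem _ fun j hj => ?_
    have hj' : ¬ ∀ q ∈ S, eval (A i) q = eval (A j) q := (Finset.mem_filter.mp hj).2
    refine Subalgebra.mul_mem _ (Subalgebra.algebraMap_mem _ _) ?_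
    exact Subalgebra.sub_mem _ (Algebra.subset_adjoin (hqS i j hj')) (Subalgebra.algebraMap_mem _ _)
  have he_self : ∀ i, eval (A i) (e i) = 1 := by
    intro i
    rw [he_def, map_prod]
    refine Finset.prod_eq_one fun j hj => ?_
    have hj' : ¬ ∀ q ∈ S, eval (A i) q = eval (A j) q := (Finset.mem_filter.mp hj).2
    have hne : eval (A i) (qs i j) - eval (A j) (qs i j) ≠ 0 := sub_ne_zero.mpr (hqne i j hj')
    simp only [map_mul, eval_C, map_sub]
    exact inv_mul_cancel₀ hne
  have he_zero : ∀ i j, ¬ (∀ q ∈ S, eval (A i) q = eval (A j) q) → eval (A j) (e i) = 0 := by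
    intro i j hij
    rw [he_def, map_prod]
    refine Finset.prod_eq_zero (i := j) (Finset.mem_filter.mpr ⟨Finset.mem_univ _, hij⟩) ?_
    simp only [map_mul, eval_C, map_sub, sub_self, mul_zero]
  have he_one : ∀ i j, (∀ q ∈ S, eval (A i) q = eval (A j) q) → eval (A j) (e i) = 1 := by
    intro i j hij
    rw [← eval_eq_of_mem_adjoin hij (he_mem i)]
    exact he_self i
  -- class sizes
  set N : ι → ℕ := fun i => (Finset.univ.filter fun j => ∀ q ∈ S, eval (A i) q = eval (A j) q).card
    with hN_def
  have hN_pos : ∀ i, 0 < N i := by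
    intro i
    refine Finset.card_pos.mpr ⟨i, Finset.mem_filter.mpr ⟨Finset.mem_univ _, fun q _ => rfl⟩⟩
  have hN_eq : ∀ i j, (∀ q ∈ S, eval (A i) q = eval (A j) q) → N i = N j := by
    intro i j hij
    simp only [hN_def]
    congr 1
    ext l
    simp only [Finset.mem_filter, Finset.mem_univ, true_and]
    constructor
    · intro hil q hq
      rw [← hij q hq, hil q hq]
    · intro hjl q hq
      rw [hij q hq, hjl q hq]
  -- the interpolant
  refine ⟨∑ i, C (eval (A i) p / (N i : ℂ)) * e i, ?_, ?_⟩
  · exact Subalgebra.sum_mem _ fun i _ =>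
      Subalgebra.mul_mem _ (Subalgebra.algebraMap_mem _ _) (he_mem i)
  · intro j
    rw [map_sum]
    have hterm : ∀ i, eval (A j) (C (eval (A i) p / (N i : ℂ)) * e i) =
        if (∀ q ∈ S, eval (A i) q = eval (A j) q) then eval (A j) p / (N j : ℂ) else 0 := by
      intro i
      by_cases hij : ∀ q ∈ S, eval (A i) q = eval (A j) q
      · rw [if_pos hij, map_mul, eval_C, he_one i j hij, mul_one, hp i j hij, hN_eq i j hij]
      · rw [if_neg hij, map_mul, he_zero i j hij, mul_zero]
    simp_rw [hterm]
    rw [Finset.sum_ite, Finset.sum_const_zero, add_zero, Finset.sum_const]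
    have hcard : (Finset.univ.filter fun i => ∀ q ∈ S, eval (A i) q = eval (A j) q).card = N j := by
      simp only [hN_def]
      congr 1
      ext l
      simp only [Finset.mem_filter, Finset.mem_univ, true_and]
      exact ⟨fun h q hq => (h q hq).symm, fun h q hq => (h q hq).symm⟩
    rw [hcard, nsmul_eq_mul]
    have hNj : (N j : ℂ) ≠ 0 := Nat.cast_ne_zero.mpr (hN_pos j).ne'
    field_simp

/-! ### The hom-polynomial form -/

/-- **(Q1) on a finite point set.**  For every finite family `A : ι → ℂ^{n×n}` of points and every
polynomial `p` determined by `HomIndist n k` (equal values at hom-indistinguishable points, vocabulary of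
`…LinearWidthDefs.lean`), some element of the algebra generated by the `hom_{F,n}` with `tw F < k` agrees
with `p` at every point of the family.  In particular this holds on the finite set of zero-one matrices of
Dwivedi–Pago–Seppelt's counting width. [cite: DwivediPagoSeppelt2026, Def. 7.1] -/
theorem exists_mem_adjoin_homPoly_eval_eq {n k : ℕ} {ι : Type*} [Fintype ι]
    (A : ι → (Fin n × Fin n → ℂ)) (p : MvPolynomial (Fin n × Fin n) ℂ)
    (hp : ∀ B B' : Fin n × Fin n → ℂ, HomIndist n k B B' → eval B p = eval B' p) :
    ∃ r ∈ Algebra.adjoin ℂ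
        {q : MvPolynomial (Fin n × Fin n) ℂ | ∃ (a b : ℕ) (E : Multiset (Fin a × Fin b)),
          Literature.Combinatorics.SimpleGraph.treewidth
              (SimpleGraph.fromRel fun u v : Fin a ⊕ Fin b =>
                ∃ e ∈ E, u = Sum.inl e.1 ∧ v = Sum.inr e.2) < k ∧
            q = homPoly E n ℂ},
      ∀ i, eval (A i) r = eval (A i) p := by
  refine exists_mem_adjoin_eval_eq _ A p fun i j hij => hp (A i) (A j) ?_
  intro a b E hE
  exact hij (homPoly E n ℂ) ⟨a, b, E, hE, rfl⟩

/-- **The zero-one form** (Dwivedi–Pago–Seppelt's setting): on the `{0,1}`-matrices, a polynomial determined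
by `HomIndist n k` coincides with an element of the algebra generated by the `hom_{F,n}`, `tw F < k`.
[cite: DwivediPagoSeppelt2026, Def. 7.1] -/
theorem exists_mem_adjoin_homPoly_eval_eq_zeroOne {n k : ℕ} (p : MvPolynomial (Fin n × Fin n) ℂ)
    (hp : ∀ B B' : Fin n × Fin n → ℂ, HomIndist n k B B' → eval B p = eval B' p) :
    ∃ r ∈ Algebra.adjoin ℂ
        {q : MvPolynomial (Fin n × Fin n) ℂ | ∃ (a b : ℕ) (E : Multiset (Fin a × Fin b)),
          Literature.Combinatorics.SimpleGraph.treewidth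
              (SimpleGraph.fromRel fun u v : Fin a ⊕ Fin b =>
                ∃ e ∈ E, u = Sum.inl e.1 ∧ v = Sum.inr e.2) < k ∧
            q = homPoly E n ℂ},
      ∀ G : Fin n × Fin n → Bool,
        eval (fun ij => if G ij then (1 : ℂ) else 0) r = eval (fun ij => if G ij then (1 : ℂ) else 0) p :=
  exists_mem_adjoin_homPoly_eval_eq (ι := Fin n × Fin n → Bool)
    (fun G ij => if G ij then (1 : ℂ) else 0) p hp

end FiniteDetermined

end Summit.ValiantsHypothesis.ValiantsHypothesis.Theorems.MonotoneRestorationQPLinearWidth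

end
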